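/-
Copyright (c) 2026 the pub-hodgecm-mathlib formalisation cell (harness21).  Prover seat hodgecm-mathlib-F0P3a-p07 (g16): line LH3 (closer stub `stub_N9`), organ J,
sub-brick (K0±-FORM-TRANSPORT) (LH3-plan (g3) RULINGS #5, 2026-09-02) for LH3-p02 (g2)'s (J-G′-JUMP) `hjump`.
-/
import Literature.NumberTheory.Automorphic.ArchRankOneJumpZeroCayley            -- ★ p850055 (LH10-p02): `unitaryGroupOfForm_diagonal_two_neg_two_eq`, `integral_comp_conj_transport`, `tendsto_std_of_eq`; brings ★ p849935 (K0±)-U11, ★ `formCongr_cayleyTwo`, ★ `unitaryGroupOfFormCongrOfEq`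
import Literature.NumberTheory.Automorphic.ArchRankOneSplitOrbitContinuity      -- ★ p850189 (F0P3a-p05) (A0-b): `hypBlockGL_mem_of_eq_over`; brings ★ FILE 1 `ArchRankOneSplitOrbitChart` (`torusU`, `unipotentU`, `hJ` currency)
import Literature.NumberTheory.Automorphic.UnitaryFormGroupUnimodular            -- ★ `isClosed_unitaryGroupOfForm_complex`, `locallyCompactSpace_unitaryGroupOfForm_complex`
import Mathlib.Analysis.Complex.Tietze                                           -- `Complex.instTietzeExtension`
import Mathlib.Topology.UrysohnsLemma                                            -- `exists_continuous_one_zero_of_isCompact`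
import HarnessLib

/-!
# The order-0 jump of the elliptic orbital integral on `U(J)`, `J = Φ₂`, for test functions ON THE GROUP and with the cone read on the group
# (Varadarajan 1989 §6.4 Thm 23; Rogawski 1990 §8.2 pp. 119, 122; Shelstad 1979 Lemma 4.3)

Topic `NumberTheory/Automorphic`; namespace `Literature.NumberTheory.Automorphic.UnitaryGroup`.  THEOREMS ONLY (no `def`, no instance, no notation, no axiom, no named fact, no
`sorry`).  Cell `pub/hodgecm-mathlib`, line LH3 (closer stub `stub_N9`, crux H413 = `stmt-HodgeConjecture-24833`), organ J, sub-brick **(K0±-FORM-TRANSPORT)** (LH3-plan (g3)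
RULINGS #5 2026-09-02T07:43Z; consumer LH3-p02 (g2) (J-G′-JUMP), hypothesis `hjump`): ★ (K0±)-U11 p849935 ∕ ★ p850055 give the one-sided values of
`ψ ↦ 2 sin ψ · ∫ f(h γ_ψ h⁻¹)` for test functions `f` on the MATRIX space `M₂(ℂ)` on the standard group `U(diag(1,−1))` ∕ on `U(Φ₂)_w = archLocal L 2 Φ₂ w`; the J organ reads
them on the GENERIC carrier `U(J)`, `hJ : J = (StdForm.antidiagonal 2).over ℂ` of ★ (A0-b) p850189 (so that the SAME lemma instance serves `U(Φ₂)_w` and the transported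
`M_w`-block of `G′`), for test functions `F ∈ C_c(U(J))` ON THE GROUP (the descended functions of (J-DESC)), with the cone value written through points of the GROUP.

WHAT IS PROVED.
* §1 (frame, generic `J`): `formCongr_cayleyTwo_of_eq_over` (`P̄ᵀ J P = diag(2,−2)`, `P = (1 1; 1 −1)`), `cayley_conj_circleDiagonal_mem_of_eq_over` (the Cayley torus
  `P·diag(u)·P⁻¹ ⊆ U(J)`), `exists_cayleyEquiv_of_eq_over` (`U(diag(2,−2)) ≃ₜ* U(J)`), and ★ p850055 §2 re-run on `U(J)`:
  **`exists_tendsto_two_sin_smul_orbitalIntegral_nhdsGT_nhdsLT_of_eq_over`** ∕ **`exists_hasOneSidedJump_two_sin_mul_orbitalIntegral_of_eq_over`** (`f : M₂(ℂ) → E ∕ ℂ`,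
  cone = the two half-cone integrals `∫_{τ>0, θ∈(0,2π]} f(P·(z•1 ± τ•diag(zi,−zi) + τ•W_±(θ))·P⁻¹)` of ★ p850055, token for token).
* §2 (group functions): `isClosedEmbedding_coe_unitaryGroupOfForm_of_eq_over` (`U(J) ↪ M₂(ℂ)` is a closed embedding: `GL₂(ℂ) ⊆ M₂(ℂ)` open, `{X ∣ X̄ᵀ J X = J}` closed and made of
  invertibles since `det J ≠ 0`), **`exists_continuous_hasCompactSupport_extend`** (Tietze + an Urysohn cut-off: every `F ∈ C_c(U(J))` is `f ∘ coe` with `f ∈ C_c(M₂(ℂ))`),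
  and the group-function head **`exists_hasOneSidedJump_two_sin_mul_orbitalIntegral_group_of_eq_over`**: for every Haar `ν` on `U(J)` ONE `C₁ > 0` with, for every
  `F ∈ C_c(U(J))` and `z ∈ S¹`, `HasOneSidedJump (ψ ↦ 2 sin ψ · ∫ F(h·⟨P diag(z e^{iψ}, z e^{−iψ}) P⁻¹,_⟩·h⁻¹) dν) (C₁ · (cone⁺ + cone⁻)(f))` for ANY `C_c` extension `f` of `F`
  (all evaluation points lie on `U(J)`, so the value does not depend on the extension — stated with the extension as data so consumers may plug the `K₁ × N` reading of
  (A0-c) `ArchRankOneSplitConeMatching` (F0P3a-p05 (g19)) by name).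
HONEST LABEL: HC_CM is proved only modulo the 7 printed citations (2 remaining: hLiu418 = stmt-HodgeConjecture-24832, h413 = stmt-HodgeConjecture-24833) until rung 0 closes; frame
and topology bookkeeping over ★ p849935 ∕ p850055, count-neutral, pays nothing by itself.

## References
* [Varadarajan1989] V. S. Varadarajan, *An Introduction to Harmonic Analysis on Semisimple Lie Groups*, Cambridge Stud. Adv. Math. 16 (1989), §6.4 Lemma 21 (c), Thm 23.
* [Rogawski1990] J. D. Rogawski, *Automorphic Representations of Unitary Groups in Three Variables*, Ann. of Math. Stud. 123 (1990), §8.2 pp. 119, 122–123; §3.6 p. 31.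
* [Shelstad1979] D. Shelstad, *Characters and inner forms of a quasi-split group over ℝ*, Compositio Math. 39 (1979), Lemma 4.3 p. 25.
* [PlatonovRapinchuk1994] V. Platonov, A. Rapinchuk, *Algebraic Groups and Number Theory* (1994), §2.3, §3.2.
-/

set_option autoImplicit false

noncomputable section

namespace Literature.NumberTheory.Automorphic.UnitaryGroup

open _root_.MeasureTheory Set Filter _root_.Topology _root_.Complex
open Literature.NumberTheory.Automorphic.Shelstad1979.StableOrbitalIntegrals
open scoped Real MatrixGroups

variable {E : Type*} [NormedAddCommGroup E] [NormedSpace ℝ E]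
variable {J : Matrix (Fin 2) (Fin 2) ℂ} (hJ : J = (StdForm.antidiagonal 2).over ℂ)

/-! ## §1 The Cayley frame on the generic carrier `U(J)`, `J = Φ₂` -/

include hJ in
/-- `P̄ᵀ J P = diag(2,−2)` for `J = Φ₂ = antidiag(1,1)` and `P = (1 1; 1 −1)` (★ `formCongr_cayleyTwo` in the `hJ` currency). [cite: Rogawski1990, §8.2 p. 122] -/
theorem formCongr_cayleyTwo_of_eq_over :
    formCongr (starRingEnd ℂ) (Matrix.GeneralLinearGroup.mkOfDetNeZero !![(1 : ℂ), 1; 1, -1] det_cayleyTwo_ne_zero) J = Matrix.diagonal ![(2 : ℂ), -2] := by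
  have h := formCongr_cayleyTwo (L := ℂ) (RingHom.id ℂ)
  have hm : ((Matrix.of fun i j : Fin 2 => if i.val + j.val + 1 = 2 then (1 : ℂ) else 0).map (RingHom.id ℂ)) =
      (Matrix.of fun i j : Fin 2 => if i.val + j.val + 1 = 2 then (1 : ℂ) else 0) := by
    ext i j; rfl
  rw [hm, ← StdForm.over_antidiagonal_eq, ← hJ] at h
  exact h

include hJ in
/-- **`P · diag(u₀, u₁) · P⁻¹ ∈ U(J)`** (`u_i ∈ S¹`): the Cayley (compact) torus of `U(Φ₂)(ℂ)`. [cite: Rogawski1990, §8.2 p. 122; §4.9 p. 54] -/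
theorem cayley_conj_circleDiagonal_mem_of_eq_over (u : Fin 2 → Circle) :
    Matrix.GeneralLinearGroup.mkOfDetNeZero !![(1 : ℂ), 1; 1, -1] det_cayleyTwo_ne_zero * circleDiagonal 2 u *
        (Matrix.GeneralLinearGroup.mkOfDetNeZero !![(1 : ℂ), 1; 1, -1] det_cayleyTwo_ne_zero)⁻¹ ∈ unitaryGroupOfForm (starRingEnd ℂ) J := by
  refine conj_mem_unitaryGroupOfForm (starRingEnd ℂ) _ _ ?_
  rw [formCongr_cayleyTwo_of_eq_over hJ]
  exact circleDiagonal_mem_unitaryGroupOfForm_diagonal 2 u _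

include hJ in
/-- The Cayley congruence `h′ ↦ P h′ P⁻¹ : U(diag(2,−2)) ≃ₜ* U(J)` with its value formula. [cite: PlatonovRapinchuk1994, §2.3] -/
theorem exists_cayleyEquiv_of_eq_over :
    ∃ e : ↥(unitaryGroupOfForm (starRingEnd ℂ) (Matrix.diagonal ![(2 : ℂ), -2])) ≃ₜ* ↥(unitaryGroupOfForm (starRingEnd ℂ) J),
      ∀ h' : ↥(unitaryGroupOfForm (starRingEnd ℂ) (Matrix.diagonal ![(2 : ℂ), -2])),
        ((e h' : ↥(unitaryGroupOfForm (starRingEnd ℂ) J)) : GL (Fin 2) ℂ) =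
          Matrix.GeneralLinearGroup.mkOfDetNeZero !![(1 : ℂ), 1; 1, -1] det_cayleyTwo_ne_zero * (h' : GL (Fin 2) ℂ) *
            (Matrix.GeneralLinearGroup.mkOfDetNeZero !![(1 : ℂ), 1; 1, -1] det_cayleyTwo_ne_zero)⁻¹ :=
  ⟨unitaryGroupOfFormCongrOfEq (starRingEnd ℂ) (Matrix.GeneralLinearGroup.mkOfDetNeZero !![(1 : ℂ), 1; 1, -1] det_cayleyTwo_ne_zero) _ _
      (formCongr_cayleyTwo_of_eq_over hJ), fun _ => rfl⟩

omit [NormedSpace ℝ E] in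
/-- `X ↦ f(A X B)` with `AB = 1 = BA` is continuous with compact support when `f` is. [folklore] -/
private theorem continuous_hasCompactSupport_comp_conj' (A B : Matrix (Fin 2) (Fin 2) ℂ) (hAB : A * B = 1) (hBA : B * A = 1)
    {f : Matrix (Fin 2) (Fin 2) ℂ → E} (hf : Continuous f) (hfc : HasCompactSupport f) :
    Continuous (fun X : Matrix (Fin 2) (Fin 2) ℂ => f (A * X * B)) ∧ HasCompactSupport (fun X : Matrix (Fin 2) (Fin 2) ℂ => f (A * X * B)) := by
  -- adapted from ★ p850055 (private `continuous_hasCompactSupport_comp_conj`)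
  refine ⟨hf.comp ((continuous_const.mul continuous_id).mul continuous_const), ?_⟩
  let φ : Matrix (Fin 2) (Fin 2) ℂ ≃ₜ Matrix (Fin 2) (Fin 2) ℂ :=
    { toFun := fun X => A * X * B
      invFun := fun X => B * X * A
      left_inv := fun X => by
        show B * (A * X * B) * A = X
        rw [← Matrix.mul_assoc, ← Matrix.mul_assoc, hBA, Matrix.one_mul, Matrix.mul_assoc, hBA, Matrix.mul_one]
      right_inv := fun X => by
        show A * (B * X * A) * B = X
        rw [← Matrix.mul_assoc, ← Matrix.mul_assoc, hAB, Matrix.one_mul, Matrix.mul_assoc, hAB, Matrix.mul_one]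
      continuous_toFun := (continuous_const.mul continuous_id).mul continuous_const
      continuous_invFun := (continuous_const.mul continuous_id).mul continuous_const }
  exact hfc.comp_homeomorph φ

include hJ in
/-- **(K0±)-U11 ON `U(J)`, `J = Φ₂`, IN THE CAYLEY FRAME** (★ p850055 §2 on the generic carrier of ★ (A0-b)): for every Haar `ν` on `U(J)` ONE `C₁ > 0` such that for every continuous
compactly supported `f : M₂(ℂ) → E` and `z ∈ S¹`, `2 sin ψ · ∫_{U(J)} f(h·(P diag(z e^{iψ}, z e^{−iψ}) P⁻¹)·h⁻¹) dν → C₁ • ∫_{τ>0,θ} f(P·(z•1 + τ•diag(iz,−iz) + τ•W_i θ)·P⁻¹)` as `ψ → 0⁺`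
and `→ C₁ • −∫ f(P·(z•1 + τ•diag(−iz, iz) + τ•W_{−i} θ)·P⁻¹)` as `ψ → 0⁻`. [cite: Varadarajan1989, §6.4 Lemma 21 (c), Thm 23] [cite: Rogawski1990, §8.2 pp. 119, 122] -/
theorem exists_tendsto_two_sin_smul_orbitalIntegral_nhdsGT_nhdsLT_of_eq_over
    [MeasurableSpace ↥(unitaryGroupOfForm (starRingEnd ℂ) J)] [BorelSpace ↥(unitaryGroupOfForm (starRingEnd ℂ) J)]
    (ν : Measure ↥(unitaryGroupOfForm (starRingEnd ℂ) J)) [ν.IsHaarMeasure] :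
    ∃ C₁ : ℝ, 0 < C₁ ∧
      ∀ (f : Matrix (Fin 2) (Fin 2) ℂ → E), Continuous f → HasCompactSupport f → ∀ z : Circle,
        Tendsto (fun ψ : ℝ => (2 * Real.sin ψ) •
            ∫ h : ↥(unitaryGroupOfForm (starRingEnd ℂ) J),
              f (((h * ⟨Matrix.GeneralLinearGroup.mkOfDetNeZero !![(1 : ℂ), 1; 1, -1] det_cayleyTwo_ne_zero *
                    circleDiagonal 2 ![z * Circle.exp ψ, z * Circle.exp (-ψ)] *
                    (Matrix.GeneralLinearGroup.mkOfDetNeZero !![(1 : ℂ), 1; 1, -1] det_cayleyTwo_ne_zero)⁻¹,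
                  cayley_conj_circleDiagonal_mem_of_eq_over hJ _⟩ * h⁻¹ :
                ↥(unitaryGroupOfForm (starRingEnd ℂ) J)) : GL (Fin 2) ℂ) : Matrix (Fin 2) (Fin 2) ℂ) ∂ν)
          (𝓝[>] 0)
          (𝓝 (C₁ • ∫ p in Ioi (0 : ℝ) ×ˢ Ioc (0 : ℝ) (2 * π),
            f ((!![(1 : ℂ), 1; 1, -1] : Matrix (Fin 2) (Fin 2) ℂ) *
              ((z : ℂ) • (1 : Matrix (Fin 2) (Fin 2) ℂ) + p.1 • Matrix.diagonal ![(z : ℂ) * I, -((z : ℂ) * I)] +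
                p.1 • !![(0 : ℂ), -((z : ℂ) * I) * cexp (-((p.2 : ℂ) * I)); ((z : ℂ) * I) * cexp ((p.2 : ℂ) * I), 0]) *
              !![(1 / 2 : ℂ), 1 / 2; 1 / 2, -(1 / 2)]))) ∧
        Tendsto (fun ψ : ℝ => (2 * Real.sin ψ) •
            ∫ h : ↥(unitaryGroupOfForm (starRingEnd ℂ) J),
              f (((h * ⟨Matrix.GeneralLinearGroup.mkOfDetNeZero !![(1 : ℂ), 1; 1, -1] det_cayleyTwo_ne_zero *
                    circleDiagonal 2 ![z * Circle.exp ψ, z * Circle.exp (-ψ)] *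
                    (Matrix.GeneralLinearGroup.mkOfDetNeZero !![(1 : ℂ), 1; 1, -1] det_cayleyTwo_ne_zero)⁻¹,
                  cayley_conj_circleDiagonal_mem_of_eq_over hJ _⟩ * h⁻¹ :
                ↥(unitaryGroupOfForm (starRingEnd ℂ) J)) : GL (Fin 2) ℂ) : Matrix (Fin 2) (Fin 2) ℂ) ∂ν)
          (𝓝[<] 0)
          (𝓝 (C₁ • -(∫ p in Ioi (0 : ℝ) ×ˢ Ioc (0 : ℝ) (2 * π),
            f ((!![(1 : ℂ), 1; 1, -1] : Matrix (Fin 2) (Fin 2) ℂ) *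
              ((z : ℂ) • (1 : Matrix (Fin 2) (Fin 2) ℂ) + p.1 • Matrix.diagonal ![-((z : ℂ) * I), (z : ℂ) * I] +
                p.1 • !![(0 : ℂ), ((z : ℂ) * I) * cexp (-((p.2 : ℂ) * I)); -((z : ℂ) * I) * cexp ((p.2 : ℂ) * I), 0]) *
              !![(1 / 2 : ℂ), 1 / 2; 1 / 2, -(1 / 2)])))) := by
  -- adapted from ★ p850055 `exists_tendsto_two_sin_smul_orbitalIntegral_cayley_nhdsGT_nhdsLT` (carrier `archLocal L 2 Φ₂ w` ↦ `U(J)`)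
  obtain ⟨e, he⟩ := exists_cayleyEquiv_of_eq_over hJ
  letI : MeasurableSpace ↥(unitaryGroupOfForm (starRingEnd ℂ) (Matrix.diagonal ![(2 : ℂ), -2])) := borel _
  haveI : BorelSpace ↥(unitaryGroupOfForm (starRingEnd ℂ) (Matrix.diagonal ![(2 : ℂ), -2])) := ⟨rfl⟩
  have hS' : ∀ u : Fin 2 → Circle, circleDiagonal 2 u ∈ unitaryGroupOfForm (starRingEnd ℂ) (Matrix.diagonal ![(2 : ℂ), -2]) := fun u =>
    circleDiagonal_mem_unitaryGroupOfForm_diagonal 2 u _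
  obtain ⟨C₁, hC₁, hlim⟩ := tendsto_std_of_eq (E := E) _ unitaryGroupOfForm_diagonal_two_neg_two_eq hS' (ν.map e.symm)
  refine ⟨C₁, hC₁, fun f hf hfc z => ?_⟩
  have hPP : ((Matrix.GeneralLinearGroup.mkOfDetNeZero !![(1 : ℂ), 1; 1, -1] det_cayleyTwo_ne_zero : GL (Fin 2) ℂ) : Matrix (Fin 2) (Fin 2) ℂ) *
      (((Matrix.GeneralLinearGroup.mkOfDetNeZero !![(1 : ℂ), 1; 1, -1] det_cayleyTwo_ne_zero)⁻¹ : GL (Fin 2) ℂ) : Matrix (Fin 2) (Fin 2) ℂ) = 1 := by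
    rw [← Units.val_mul, mul_inv_cancel, Units.val_one]
  have hPP' : (((Matrix.GeneralLinearGroup.mkOfDetNeZero !![(1 : ℂ), 1; 1, -1] det_cayleyTwo_ne_zero)⁻¹ : GL (Fin 2) ℂ) : Matrix (Fin 2) (Fin 2) ℂ) *
      ((Matrix.GeneralLinearGroup.mkOfDetNeZero !![(1 : ℂ), 1; 1, -1] det_cayleyTwo_ne_zero : GL (Fin 2) ℂ) : Matrix (Fin 2) (Fin 2) ℂ) = 1 := by
    rw [← Units.val_mul, inv_mul_cancel, Units.val_one]
  obtain ⟨hfP, hfPc⟩ := continuous_hasCompactSupport_comp_conj' (E := E) _ _ hPP hPP' hf hfc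
  obtain ⟨hGT, hLT⟩ := hlim _ hfP hfPc z
  rw [Matrix.GeneralLinearGroup.val_mkOfDetNeZero, coe_inv_cayleyTwo] at hGT hLT
  have hγ : ∀ ψ : ℝ, (⟨Matrix.GeneralLinearGroup.mkOfDetNeZero !![(1 : ℂ), 1; 1, -1] det_cayleyTwo_ne_zero *
        circleDiagonal 2 ![z * Circle.exp ψ, z * Circle.exp (-ψ)] * (Matrix.GeneralLinearGroup.mkOfDetNeZero !![(1 : ℂ), 1; 1, -1] det_cayleyTwo_ne_zero)⁻¹,
        cayley_conj_circleDiagonal_mem_of_eq_over hJ _⟩ : ↥(unitaryGroupOfForm (starRingEnd ℂ) J)) =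
      e ⟨circleDiagonal 2 ![z * Circle.exp ψ, z * Circle.exp (-ψ)], hS' _⟩ := fun ψ =>
    Subtype.ext (he ⟨circleDiagonal 2 ![z * Circle.exp ψ, z * Circle.exp (-ψ)], hS' _⟩).symm
  have key : ∀ ψ : ℝ, (2 * Real.sin ψ) •
      ∫ h : ↥(unitaryGroupOfForm (starRingEnd ℂ) J),
        f (((h * ⟨Matrix.GeneralLinearGroup.mkOfDetNeZero !![(1 : ℂ), 1; 1, -1] det_cayleyTwo_ne_zero *
              circleDiagonal 2 ![z * Circle.exp ψ, z * Circle.exp (-ψ)] *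
              (Matrix.GeneralLinearGroup.mkOfDetNeZero !![(1 : ℂ), 1; 1, -1] det_cayleyTwo_ne_zero)⁻¹,
            cayley_conj_circleDiagonal_mem_of_eq_over hJ _⟩ * h⁻¹ :
          ↥(unitaryGroupOfForm (starRingEnd ℂ) J)) : GL (Fin 2) ℂ) : Matrix (Fin 2) (Fin 2) ℂ) ∂ν =
      (2 * Real.sin ψ) •
        ∫ h' : ↥(unitaryGroupOfForm (starRingEnd ℂ) (Matrix.diagonal ![(2 : ℂ), -2])),
          (fun X : Matrix (Fin 2) (Fin 2) ℂ => f ((!![(1 : ℂ), 1; 1, -1] : Matrix (Fin 2) (Fin 2) ℂ) * X * !![(1 / 2 : ℂ), 1 / 2; 1 / 2, -(1 / 2)]))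
          (((h' * ⟨circleDiagonal 2 ![z * Circle.exp ψ, z * Circle.exp (-ψ)], hS' _⟩ * h'⁻¹ :
            ↥(unitaryGroupOfForm (starRingEnd ℂ) (Matrix.diagonal ![(2 : ℂ), -2]))) : GL (Fin 2) ℂ) : Matrix (Fin 2) (Fin 2) ℂ) ∂(ν.map e.symm) := fun ψ => by
    rw [hγ ψ, integral_comp_conj_transport _ _ e _ he ν f, Matrix.GeneralLinearGroup.val_mkOfDetNeZero, coe_inv_cayleyTwo]
  exact ⟨hGT.congr fun ψ => (key ψ).symm, hLT.congr fun ψ => (key ψ).symm⟩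

include hJ in
/-- **THE ORDER-0 JUMP ON `U(J)`, `J = Φ₂`, IN THE CAYLEY FRAME** (`E = ℂ`, `f : M₂(ℂ) → ℂ`): for every Haar `ν` ONE `C₁ > 0` such that for every continuous compactly supported `f`
and `z ∈ S¹`, `ψ ↦ 2 sin ψ · ∫_{U(J)} f(h·(P diag(z e^{iψ}, z e^{−iψ}) P⁻¹)·h⁻¹) dν` jumps at `ψ = 0` by `C₁ ·` (both half-cone integrals in the Cayley frame).
[cite: Shelstad1979, Lemma 4.3 p. 25] [cite: Varadarajan1989, §6.4 Thm 23] [cite: Rogawski1990, §8.2 pp. 119, 122] -/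
theorem exists_hasOneSidedJump_two_sin_mul_orbitalIntegral_of_eq_over
    [MeasurableSpace ↥(unitaryGroupOfForm (starRingEnd ℂ) J)] [BorelSpace ↥(unitaryGroupOfForm (starRingEnd ℂ) J)]
    (ν : Measure ↥(unitaryGroupOfForm (starRingEnd ℂ) J)) [ν.IsHaarMeasure] :
    ∃ C₁ : ℝ, 0 < C₁ ∧
      ∀ (f : Matrix (Fin 2) (Fin 2) ℂ → ℂ), Continuous f → HasCompactSupport f → ∀ z : Circle,
        HasOneSidedJump (fun ψ : ℝ => (2 * Real.sin ψ : ℂ) *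
            ∫ h : ↥(unitaryGroupOfForm (starRingEnd ℂ) J),
              f (((h * ⟨Matrix.GeneralLinearGroup.mkOfDetNeZero !![(1 : ℂ), 1; 1, -1] det_cayleyTwo_ne_zero *
                    circleDiagonal 2 ![z * Circle.exp ψ, z * Circle.exp (-ψ)] *
                    (Matrix.GeneralLinearGroup.mkOfDetNeZero !![(1 : ℂ), 1; 1, -1] det_cayleyTwo_ne_zero)⁻¹,
                  cayley_conj_circleDiagonal_mem_of_eq_over hJ _⟩ * h⁻¹ :
                ↥(unitaryGroupOfForm (starRingEnd ℂ) J)) : GL (Fin 2) ℂ) : Matrix (Fin 2) (Fin 2) ℂ) ∂ν)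
          ((C₁ : ℂ) * ((∫ p in Ioi (0 : ℝ) ×ˢ Ioc (0 : ℝ) (2 * π),
              f ((!![(1 : ℂ), 1; 1, -1] : Matrix (Fin 2) (Fin 2) ℂ) *
                ((z : ℂ) • (1 : Matrix (Fin 2) (Fin 2) ℂ) + p.1 • Matrix.diagonal ![(z : ℂ) * I, -((z : ℂ) * I)] +
                  p.1 • !![(0 : ℂ), -((z : ℂ) * I) * cexp (-((p.2 : ℂ) * I)); ((z : ℂ) * I) * cexp ((p.2 : ℂ) * I), 0]) *
                !![(1 / 2 : ℂ), 1 / 2; 1 / 2, -(1 / 2)])) +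
            ∫ p in Ioi (0 : ℝ) ×ˢ Ioc (0 : ℝ) (2 * π),
              f ((!![(1 : ℂ), 1; 1, -1] : Matrix (Fin 2) (Fin 2) ℂ) *
                ((z : ℂ) • (1 : Matrix (Fin 2) (Fin 2) ℂ) + p.1 • Matrix.diagonal ![-((z : ℂ) * I), (z : ℂ) * I] +
                  p.1 • !![(0 : ℂ), ((z : ℂ) * I) * cexp (-((p.2 : ℂ) * I)); -((z : ℂ) * I) * cexp ((p.2 : ℂ) * I), 0]) *
                !![(1 / 2 : ℂ), 1 / 2; 1 / 2, -(1 / 2)]))) := by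
  obtain ⟨C₁, hC₁, h⟩ := exists_tendsto_two_sin_smul_orbitalIntegral_nhdsGT_nhdsLT_of_eq_over (E := ℂ) hJ ν
  refine ⟨C₁, hC₁, fun f hf hfc z => ?_⟩
  obtain ⟨hp, hm⟩ := h f hf hfc z
  have hsmul : ∀ (ψ : ℝ) (x : ℂ), (2 * Real.sin ψ) • x = (2 * Real.sin ψ : ℂ) * x := fun ψ x => by
    rw [Complex.real_smul]; push_cast; ring
  refine ⟨_, _, hp.congr fun ψ => hsmul ψ _, hm.congr fun ψ => hsmul ψ _, ?_⟩
  rw [Complex.real_smul, Complex.real_smul]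
  ring

/-! ## §2 Test functions on the group: `U(J) ↪ M₂(ℂ)` is a closed embedding, Tietze, and the group-function head -/

section ClosedEmbedding

open scoped Matrix.Norms.L2Operator

include hJ in
/-- **`U(J) ↪ M₂(ℂ)` (through `GL₂(ℂ)`) is a closed embedding**: `GL₂(ℂ) ⊆ M₂(ℂ)` is an open embedding (Mathlib `Units.isOpenEmbedding_val`), `U(J)` carries the subspace
topology of `GL₂(ℂ)`, and the image `{X ∣ X̄ᵀ J X = J}` is closed in `M₂(ℂ)` — its points are invertible because `det J = −1 ≠ 0`. [cite: PlatonovRapinchuk1994, §3.2] -/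
theorem isClosedEmbedding_coe_unitaryGroupOfForm_of_eq_over :
    IsClosedEmbedding (fun g : ↥(unitaryGroupOfForm (starRingEnd ℂ) J) => ((g : GL (Fin 2) ℂ) : Matrix (Fin 2) (Fin 2) ℂ)) := by
  have hemb : IsEmbedding (fun g : ↥(unitaryGroupOfForm (starRingEnd ℂ) J) => ((g : GL (Fin 2) ℂ) : Matrix (Fin 2) (Fin 2) ℂ)) :=
    (Units.isOpenEmbedding_val (R := Matrix (Fin 2) (Fin 2) ℂ)).isEmbedding.comp IsEmbedding.subtypeVal
  refine ⟨hemb, ?_⟩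
  -- the range is the closed set `{X | X̄ᵀ J X = J}`
  have hJdet : J.det ≠ 0 := by
    rw [hJ, StdForm.over_antidiagonal_eq]
    have : (Matrix.of fun i j : Fin 2 => if i.val + j.val + 1 = 2 then (1 : ℂ) else 0) = !![(0 : ℂ), 1; 1, 0] := by
      ext i j; fin_cases i <;> fin_cases j <;> rfl
    rw [this, Matrix.det_fin_two_of]; norm_num
  have hrange : Set.range (fun g : ↥(unitaryGroupOfForm (starRingEnd ℂ) J) => ((g : GL (Fin 2) ℂ) : Matrix (Fin 2) (Fin 2) ℂ)) =
      {X : Matrix (Fin 2) (Fin 2) ℂ | (X.map (starRingEnd ℂ)).transpose * J * X = J} := by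
    ext X
    constructor
    · rintro ⟨g, rfl⟩
      exact mem_unitaryGroupOfForm_iff.1 g.2
    · intro hX
      have hXdet : X.det ≠ 0 := by
        intro h0
        have h := congrArg Matrix.det hX
        rw [Matrix.det_mul, Matrix.det_mul, h0, mul_zero] at h
        exact hJdet h.symm
      refine ⟨⟨Matrix.GeneralLinearGroup.mkOfDetNeZero X hXdet, ?_⟩, ?_⟩
      · rw [mem_unitaryGroupOfForm_iff, Matrix.GeneralLinearGroup.val_mkOfDetNeZero]; exact hX
      · rfl
  rw [hrange]
  exact isClosed_eq ((((continuous_id.matrix_map Complex.continuous_conj).matrix_transpose.mul continuous_const).mul continuous_id))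
    continuous_const

end ClosedEmbedding

include hJ in
/-- **Every `F ∈ C_c(U(J))` is the restriction of some `f ∈ C_c(M₂(ℂ))`**: Tietze's extension along the closed embedding `U(J) ↪ M₂(ℂ)` (Mathlib `Complex.instTietzeExtension`),
cut off by an Urysohn function that is `1` on the image of `tsupport F` and compactly supported. [cite: PlatonovRapinchuk1994, §3.2] -/
theorem exists_continuous_hasCompactSupport_extend (F : ↥(unitaryGroupOfForm (starRingEnd ℂ) J) → ℂ) (hF : Continuous F) (hFc : HasCompactSupport F) :
    ∃ f : Matrix (Fin 2) (Fin 2) ℂ → ℂ, Continuous f ∧ HasCompactSupport f ∧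
      ∀ g : ↥(unitaryGroupOfForm (starRingEnd ℂ) J), f ((g : GL (Fin 2) ℂ) : Matrix (Fin 2) (Fin 2) ℂ) = F g := by
  have he := isClosedEmbedding_coe_unitaryGroupOfForm_of_eq_over hJ
  -- Tietze
  obtain ⟨g, hg⟩ := ContinuousMap.exists_extension' he ⟨F, hF⟩
  -- Urysohn cut-off on the image of the support
  haveI : LocallyCompactSpace (Matrix (Fin 2) (Fin 2) ℂ) := inferInstanceAs (LocallyCompactSpace (Fin 2 → Fin 2 → ℂ))
  have hKc : IsCompact ((fun g : ↥(unitaryGroupOfForm (starRingEnd ℂ) J) => ((g : GL (Fin 2) ℂ) : Matrix (Fin 2) (Fin 2) ℂ)) '' tsupport F) :=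
    hFc.image he.continuous
  obtain ⟨χ, hχ1, -, hχc, -⟩ := exists_continuous_one_zero_of_isCompact hKc isClosed_empty (Set.disjoint_empty _)
  refine ⟨fun X => (χ X : ℂ) * g X, (Complex.continuous_ofReal.comp χ.continuous).mul g.continuous, ?_, fun x => ?_⟩
  · exact (hχc.comp_left Complex.ofReal_zero).mul_right
  · have hgx : g ((x : GL (Fin 2) ℂ) : Matrix (Fin 2) (Fin 2) ℂ) = F x := by
      have := congrFun hg x
      simpa using this
    show (χ _ : ℂ) * g _ = F x
    rw [hgx]
    by_cases hx : x ∈ tsupport F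
    · rw [hχ1 ⟨x, hx, rfl⟩]; simp
    · rw [image_eq_zero_of_notMem_tsupport hx, mul_zero]

include hJ in
/-- **(K0±) FOR TEST FUNCTIONS ON THE GROUP `U(J)`** (`J = Φ₂`; the `hjump` shape of (J-G′-JUMP)): for every Haar `ν` on `U(J)` ONE `C₁ > 0` such that for every `F ∈ C_c(U(J))`,
every `z ∈ S¹`, and EVERY continuous compactly supported `f : M₂(ℂ) → ℂ` extending `F` (`f ↑↑g = F g`; one exists by `exists_continuous_hasCompactSupport_extend`), the normalised
elliptic orbital integral `ψ ↦ 2 sin ψ · ∫_{U(J)} F(h·⟨P diag(z e^{iψ}, z e^{−iψ}) P⁻¹,_⟩·h⁻¹) dν(h)` jumps at `ψ = 0` by `C₁ · (cone⁺ + cone⁻)(f, z)` — the Cayley half-cone integrals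
of ★ p850055 (all of whose points `P(z•1 ± τ…)P⁻¹ = z·k n k⁻¹` lie ON `U(J)`, so the value is independent of the extension; the `K₁ × N` reading is (A0-c)'s matching lemma).
[cite: Shelstad1979, Lemma 4.3 p. 25] [cite: Varadarajan1989, §6.4 Thm 23] [cite: Rogawski1990, §8.2 pp. 119, 122] -/
theorem exists_hasOneSidedJump_two_sin_mul_orbitalIntegral_group_of_eq_over
    [MeasurableSpace ↥(unitaryGroupOfForm (starRingEnd ℂ) J)] [BorelSpace ↥(unitaryGroupOfForm (starRingEnd ℂ) J)]
    (ν : Measure ↥(unitaryGroupOfForm (starRingEnd ℂ) J)) [ν.IsHaarMeasure] :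
    ∃ C₁ : ℝ, 0 < C₁ ∧
      ∀ (F : ↥(unitaryGroupOfForm (starRingEnd ℂ) J) → ℂ), Continuous F → HasCompactSupport F →
      ∀ (f : Matrix (Fin 2) (Fin 2) ℂ → ℂ), Continuous f → HasCompactSupport f →
        (∀ g : ↥(unitaryGroupOfForm (starRingEnd ℂ) J), f ((g : GL (Fin 2) ℂ) : Matrix (Fin 2) (Fin 2) ℂ) = F g) → ∀ z : Circle,
        HasOneSidedJump (fun ψ : ℝ => (2 * Real.sin ψ : ℂ) *
            ∫ h : ↥(unitaryGroupOfForm (starRingEnd ℂ) J),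
              F (h * ⟨Matrix.GeneralLinearGroup.mkOfDetNeZero !![(1 : ℂ), 1; 1, -1] det_cayleyTwo_ne_zero *
                    circleDiagonal 2 ![z * Circle.exp ψ, z * Circle.exp (-ψ)] *
                    (Matrix.GeneralLinearGroup.mkOfDetNeZero !![(1 : ℂ), 1; 1, -1] det_cayleyTwo_ne_zero)⁻¹,
                  cayley_conj_circleDiagonal_mem_of_eq_over hJ _⟩ * h⁻¹) ∂ν)
          ((C₁ : ℂ) * ((∫ p in Ioi (0 : ℝ) ×ˢ Ioc (0 : ℝ) (2 * π),
              f ((!![(1 : ℂ), 1; 1, -1] : Matrix (Fin 2) (Fin 2) ℂ) *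
                ((z : ℂ) • (1 : Matrix (Fin 2) (Fin 2) ℂ) + p.1 • Matrix.diagonal ![(z : ℂ) * I, -((z : ℂ) * I)] +
                  p.1 • !![(0 : ℂ), -((z : ℂ) * I) * cexp (-((p.2 : ℂ) * I)); ((z : ℂ) * I) * cexp ((p.2 : ℂ) * I), 0]) *
                !![(1 / 2 : ℂ), 1 / 2; 1 / 2, -(1 / 2)])) +
            ∫ p in Ioi (0 : ℝ) ×ˢ Ioc (0 : ℝ) (2 * π),
              f ((!![(1 : ℂ), 1; 1, -1] : Matrix (Fin 2) (Fin 2) ℂ) *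
                ((z : ℂ) • (1 : Matrix (Fin 2) (Fin 2) ℂ) + p.1 • Matrix.diagonal ![-((z : ℂ) * I), (z : ℂ) * I] +
                  p.1 • !![(0 : ℂ), ((z : ℂ) * I) * cexp (-((p.2 : ℂ) * I)); -((z : ℂ) * I) * cexp ((p.2 : ℂ) * I), 0]) *
                !![(1 / 2 : ℂ), 1 / 2; 1 / 2, -(1 / 2)]))) := by
  obtain ⟨C₁, hC₁, h⟩ := exists_hasOneSidedJump_two_sin_mul_orbitalIntegral_of_eq_over hJ ν
  refine ⟨C₁, hC₁, fun F _ _ f hf hfc hfF z => ?_⟩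
  have key := h f hf hfc z
  have hfun : (fun ψ : ℝ => (2 * Real.sin ψ : ℂ) *
      ∫ h : ↥(unitaryGroupOfForm (starRingEnd ℂ) J),
        F (h * ⟨Matrix.GeneralLinearGroup.mkOfDetNeZero !![(1 : ℂ), 1; 1, -1] det_cayleyTwo_ne_zero *
              circleDiagonal 2 ![z * Circle.exp ψ, z * Circle.exp (-ψ)] *
              (Matrix.GeneralLinearGroup.mkOfDetNeZero !![(1 : ℂ), 1; 1, -1] det_cayleyTwo_ne_zero)⁻¹,
            cayley_conj_circleDiagonal_mem_of_eq_over hJ _⟩ * h⁻¹) ∂ν) =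
      (fun ψ : ℝ => (2 * Real.sin ψ : ℂ) *
        ∫ h : ↥(unitaryGroupOfForm (starRingEnd ℂ) J),
          f (((h * ⟨Matrix.GeneralLinearGroup.mkOfDetNeZero !![(1 : ℂ), 1; 1, -1] det_cayleyTwo_ne_zero *
                circleDiagonal 2 ![z * Circle.exp ψ, z * Circle.exp (-ψ)] *
                (Matrix.GeneralLinearGroup.mkOfDetNeZero !![(1 : ℂ), 1; 1, -1] det_cayleyTwo_ne_zero)⁻¹,
              cayley_conj_circleDiagonal_mem_of_eq_over hJ _⟩ * h⁻¹ :
            ↥(unitaryGroupOfForm (starRingEnd ℂ) J)) : GL (Fin 2) ℂ) : Matrix (Fin 2) (Fin 2) ℂ) ∂ν) := by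
    funext ψ
    congr 1
    exact integral_congr_ae (Eventually.of_forall fun h => (hfF _).symm)
  rw [hfun]
  exact key

end Literature.NumberTheory.Automorphic.UnitaryGroup

end
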